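import Summits.AtomisticToContinuum.HydrodynamicLimit.Theses.JParityClosure
import Summits.AtomisticToContinuum.HydrodynamicLimit.Theorems.DensityCap.Negative.MollifiedDensity
import Literature.Analysis.FluidPDE.HardSphereRegularGeometry
import Literature.Analysis.FluidPDE.HardSphereTorusMeasure
import Literature.Analysis.FluidPDE.HardSpherePhaseSpaceProofs

/-!
# drefute gen-2: STUB E `stub_gridUpgrade` (lead's stub) of line `lipschitz-clock-free-past-cap`
(crux `JParityClosure.DensityCap`, stmt-AtomisticToContinuum-13082) — proof attempt, verbatim signature

The finite-grid upgrade, measure-theoretic assembly: nets (`exists_euclidDist_net`, `exists_time_net` — gen-1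
drefute's `DrefuteNetProbe`, copied), the sure inclusion STUB D (gen-1 drefute's proof, copied verbatim as
`stub_capEventSubset`), the kernel glue (`cone_lipschitz_*`, `mollDensity_lipschitz_centre`,
`clock_of_meanDisplacement` — gen-1 §7, copied), `localGibbsLaw_compl_good` (skeleton §2, copied), and the new part:
`capEvent ⊆ goodᶜ ∪ {K < K̄} ∪ ⋃ grid events`, union bound on the outer measure, `tendsto_finset_sum` of the
`hlln` limits, `Tendsto ⇒ ∃ N₀`.
refuter-drefute-stmt-AtomisticToContinuum-13082-g2-0, 2026-08-16.
-/

noncomputable section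

namespace DrefuteG2.StubE

open MeasureTheory Filter Set Topology
open scoped ENNReal BigOperators
open Literature.MathematicalPhysics.KineticTheory Literature.Analysis.FluidPDE
open Summit.AtomisticToContinuum.HydrodynamicLimit.Theorems.DensityCapNegative
  (cone mollDensity capEvent CapLimit mollDensity_eq cone_nonneg cone_le cone_self)
open Summit.AtomisticToContinuum.HydrodynamicLimit.Theorems.PolynomialCompressionPDE (Flows)

/-! ## §1 Nets (gen-1 `DrefuteNetProbe`, copied) -/

theorem exists_euclidDist_net {δ : ℝ} (hδ : 0 < δ) :
    ∃ Sx : Finset T3, ∀ x : T3, ∃ x' ∈ Sx, Torus.euclidDist x x' ≤ δ := by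
  have h3 : (0 : ℝ) < Real.sqrt 3 := Real.sqrt_pos.2 (by norm_num)
  obtain ⟨S, -, hSfin, hcover⟩ :=
    finite_cover_balls_of_compact (isCompact_univ (X := T3)) (e := δ / Real.sqrt 3) (by positivity)
  refine ⟨hSfin.toFinset, fun x => ?_⟩
  obtain ⟨x', hx', hxx'⟩ := Set.mem_iUnion₂.1 (hcover (Set.mem_univ x))
  refine ⟨x', hSfin.mem_toFinset.2 hx', ?_⟩
  have hle := Torus.euclidDist_le_holds x x'
  rw [Fintype.card_fin] at hle
  have hd : ‖x - x'‖ < δ / Real.sqrt 3 := by rwa [Metric.mem_ball, dist_eq_norm] at hxx'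
  calc Torus.euclidDist x x' ≤ Real.sqrt (3 : ℕ) * ‖x - x'‖ := hle
    _ ≤ Real.sqrt 3 * (δ / Real.sqrt 3) := by
        push_cast
        exact mul_le_mul_of_nonneg_left hd.le h3.le
    _ = δ := by field_simp

theorem exists_time_net {t δ : ℝ} (ht : 0 ≤ t) (hδ : 0 < δ) :
    ∃ St : Finset ℝ, (∀ s ∈ St, s ∈ Icc 0 t) ∧ ∀ s ∈ Icc 0 t, ∃ s' ∈ St, |s - s'| ≤ δ := by
  obtain ⟨M, hM⟩ := exists_nat_gt (t / δ)
  have hMpos : (0 : ℝ) < M := lt_of_le_of_lt (div_nonneg ht hδ.le) hM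
  have hstep : t / M ≤ δ := by
    rw [div_le_iff₀ hMpos]
    have := (div_lt_iff₀ hδ).1 hM
    linarith
  refine ⟨(Finset.range (M + 1)).image fun k : ℕ => (k : ℝ) * (t / M), ?_, ?_⟩
  · intro s hs
    obtain ⟨k, hk, rfl⟩ := Finset.mem_image.1 hs
    have hkM : (k : ℝ) ≤ M := by exact_mod_cast Nat.lt_succ_iff.1 (Finset.mem_range.1 hk)
    refine ⟨by positivity, ?_⟩
    calc (k : ℝ) * (t / M) ≤ M * (t / M) := by gcongr
      _ = t := by field_simp
  · intro s hs
    rcases eq_or_lt_of_le ht with rfl | htpos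
    · refine ⟨0, Finset.mem_image.2 ⟨0, by simp, by simp⟩, ?_⟩
      have : s = 0 := le_antisymm hs.2 hs.1
      simp [this, hδ.le]
    · have hh : 0 < t / M := div_pos htpos hMpos
      set k := ⌊s / (t / M)⌋₊ with hk
      have hks : (k : ℝ) * (t / M) ≤ s := by
        have := Nat.floor_le (div_nonneg hs.1 hh.le)
        rw [← hk] at this
        calc (k : ℝ) * (t / M) ≤ s / (t / M) * (t / M) := by gcongr
          _ = s := by field_simp
      have hsk : s < ((k : ℝ) + 1) * (t / M) := by
        have := Nat.lt_floor_add_one (s / (t / M))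
        rw [← hk] at this
        calc s = s / (t / M) * (t / M) := by field_simp
          _ < ((k : ℝ) + 1) * (t / M) := by gcongr
      have hkM : k ≤ M := by
        have h1 : (k : ℝ) * (t / M) ≤ t := hks.trans hs.2
        have h2 : (k : ℝ) ≤ M := by
          by_contra hlt
          rw [not_le] at hlt
          have : (M : ℝ) * (t / M) < k * (t / M) := by gcongr
          rw [show (M : ℝ) * (t / M) = t by field_simp] at this
          linarith
        exact_mod_cast h2
      refine ⟨(k : ℝ) * (t / M), Finset.mem_image.2 ⟨k, Finset.mem_range.2 (Nat.lt_succ_of_le hkM), rfl⟩, ?_⟩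
      rw [abs_of_nonneg (by linarith)]
      calc s - k * (t / M) ≤ t / M := by nlinarith
        _ ≤ δ := hstep

/-! ## §2 Kernel glue (gen-1 §7, copied; triangle inequality re-proved to keep imports light) -/

theorem euclidDist_triangle' (x y w : T3) :
    Torus.euclidDist x w ≤ Torus.euclidDist x y + Torus.euclidDist y w := by
  have hproj : Literature.Analysis.FunctionSpaces.Torus.proj (Torus.reprSym (x - y) + Torus.reprSym (y - w)) =
      x - w := by
    rw [Literature.Analysis.FunctionSpaces.Torus.proj_add, Torus.proj_reprSym, Torus.proj_reprSym]
    abel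
  rw [Torus.euclidDist_eq, Torus.euclidDist_eq, Torus.euclidDist_eq]
  exact (Torus.norm_reprSym_le_of_proj_eq hproj).trans (norm_add_le _ _)

theorem cone_lipschitz_centre {r : ℝ} (hr : 0 < r) (q x x' : T3) :
    |cone r q x - cone r q x'| ≤ 3 / (Real.pi * r ^ 4) * Torus.euclidDist x x' := by
  unfold cone
  have hc : 0 ≤ 3 / (Real.pi * r ^ 3) := by positivity
  have htri : |Torus.euclidDist q x - Torus.euclidDist q x'| ≤ Torus.euclidDist x x' := by
    rw [abs_sub_le_iff]
    constructor
    · have := euclidDist_triangle' q x' x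
      rw [Torus.euclidDist_comm x' x] at this
      linarith
    · have := euclidDist_triangle' q x x'
      linarith
  rw [← mul_sub, abs_mul, abs_of_nonneg hc]
  calc 3 / (Real.pi * r ^ 3) * |max (1 - Torus.euclidDist q x / r) 0 - max (1 - Torus.euclidDist q x' / r) 0|
      ≤ 3 / (Real.pi * r ^ 3) * |(1 - Torus.euclidDist q x / r) - (1 - Torus.euclidDist q x' / r)| :=
        mul_le_mul_of_nonneg_left (abs_max_sub_max_le_abs _ _ _) hc
    _ = 3 / (Real.pi * r ^ 3) * (|Torus.euclidDist q x - Torus.euclidDist q x'| / r) := by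
        rw [show (1 - Torus.euclidDist q x / r) - (1 - Torus.euclidDist q x' / r) =
          -((Torus.euclidDist q x - Torus.euclidDist q x') / r) by ring, abs_neg, abs_div, abs_of_pos hr]
    _ ≤ 3 / (Real.pi * r ^ 3) * (Torus.euclidDist x x' / r) := by gcongr
    _ = 3 / (Real.pi * r ^ 4) * Torus.euclidDist x x' := by
        field_simp

theorem cone_lipschitz_particle {r : ℝ} (hr : 0 < r) (q q' x : T3) :
    |cone r q x - cone r q' x| ≤ 3 / (Real.pi * r ^ 4) * Torus.euclidDist q q' := by
  have hsymm : ∀ a b : T3, cone r a b = cone r b a := fun a b => by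
    unfold cone; rw [Torus.euclidDist_comm]
  rw [hsymm q x, hsymm q' x]
  exact cone_lipschitz_centre hr x q q'

theorem mollDensity_lipschitz_centre {r : ℝ} (hr : 0 < r) {n : ℕ} (w : Config n (Fin 3) T3) (x x' : T3) :
    |mollDensity r w x - mollDensity r w x'| ≤ 3 / (Real.pi * r ^ 4) * Torus.euclidDist x x' := by
  rw [mollDensity_eq, mollDensity_eq, ← mul_sub, ← Finset.sum_sub_distrib, abs_mul,
    abs_of_nonneg (inv_nonneg.2 (Nat.cast_nonneg n))]
  rcases Nat.eq_zero_or_pos n with hn | hn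
  · subst hn
    simp only [Nat.cast_zero, inv_zero, zero_mul]
    exact mul_nonneg (by positivity) (norm_nonneg _)
  · calc (n : ℝ)⁻¹ * |∑ i, (cone r (w i).1 x - cone r (w i).1 x')|
        ≤ (n : ℝ)⁻¹ * ∑ i, |cone r (w i).1 x - cone r (w i).1 x'| := by
          gcongr
          exact Finset.abs_sum_le_sum_abs _ _
      _ ≤ (n : ℝ)⁻¹ * ∑ _i : Fin n, 3 / (Real.pi * r ^ 4) * Torus.euclidDist x x' := by
          gcongr with i _
          exact cone_lipschitz_centre hr _ _ _
      _ = 3 / (Real.pi * r ^ 4) * Torus.euclidDist x x' := by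
          rw [Finset.sum_const, Finset.card_univ, Fintype.card_fin, nsmul_eq_mul, ← mul_assoc,
            inv_mul_cancel₀ (by exact_mod_cast hn.ne'), one_mul]

theorem clock_of_meanDisplacement {r : ℝ} (hr : 0 < r) {n : ℕ} (w w' : Config n (Fin 3) T3) (x₀ : T3) {B : ℝ}
    (hdisp : (n : ℝ)⁻¹ * ∑ i, Torus.euclidDist ((w' i).1) ((w i).1) ≤ B) :
    |mollDensity r w' x₀ - mollDensity r w x₀| ≤ 3 / (Real.pi * r ^ 4) * B := by
  rw [mollDensity_eq, mollDensity_eq, ← mul_sub, ← Finset.sum_sub_distrib, abs_mul,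
    abs_of_nonneg (inv_nonneg.2 (Nat.cast_nonneg n))]
  have hc : 0 ≤ 3 / (Real.pi * r ^ 4) := by positivity
  calc (n : ℝ)⁻¹ * |∑ i, (cone r (w' i).1 x₀ - cone r (w i).1 x₀)|
      ≤ (n : ℝ)⁻¹ * ∑ i, |cone r (w' i).1 x₀ - cone r (w i).1 x₀| := by
        gcongr
        exact Finset.abs_sum_le_sum_abs _ _
    _ ≤ (n : ℝ)⁻¹ * ∑ i, 3 / (Real.pi * r ^ 4) * Torus.euclidDist (w' i).1 (w i).1 := by
        gcongr with i _
        exact cone_lipschitz_particle hr _ _ _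
    _ = 3 / (Real.pi * r ^ 4) * ((n : ℝ)⁻¹ * ∑ i, Torus.euclidDist (w' i).1 (w i).1) := by
        rw [← Finset.mul_sum]
        ring
    _ ≤ 3 / (Real.pi * r ^ 4) * B := mul_le_mul_of_nonneg_left hdisp hc

/-! ## §3 STUB D (gen-1 drefute's proof, copied verbatim) -/

theorem stub_capEventSubset {ε : ℝ} {n : ℕ} (Ψ : HardSphereFlow (Torus.geometry (Fin 3)) ε n)
    (ρ : ℝ → T3 → ℝ) {t η r r₀ τ₀ K δx δt : ℝ} (hr : 0 < r)
    (hclock : ∀ z ∈ Ψ.good, ∀ (s s' : ℝ) (x₀ : T3),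
      |mollDensity r (Ψ.flow s' z) x₀ - mollDensity r (Ψ.flow s z) x₀| ≤
        3 / (Real.pi * r ^ 4) * Real.sqrt (2 * ((n : ℝ)⁻¹ * configEnergy z)) * |s' - s|)
    (hlip : ∀ (w : Config n (Fin 3) T3) (x x' : T3),
      |mollDensity r w x - mollDensity r w x'| ≤ 3 / (Real.pi * r ^ 4) * Torus.euclidDist x x')
    (hmod1 : ∀ s ∈ Icc 0 t, ∀ x : T3, ∫ y, cone r y x * ρ s y ≤ ρ s x + η / 4)
    (hmod2 : ∀ s ∈ Icc 0 t, ∀ s' ∈ Icc 0 t, |s - s'| ≤ τ₀ →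
      ∀ x x' : T3, Torus.euclidDist x x' ≤ r₀ → |ρ s x - ρ s' x'| ≤ η / 4)
    (Sx : Finset T3) (hSx : ∀ x : T3, ∃ x' ∈ Sx, Torus.euclidDist x x' ≤ δx)
    (hδx₁ : δx ≤ r₀) (hδx₂ : 3 / (Real.pi * r ^ 4) * δx ≤ η / 8)
    (St : Finset ℝ) (hSt : ∀ s ∈ St, s ∈ Icc 0 t) (hSt' : ∀ s ∈ Icc 0 t, ∃ s' ∈ St, |s - s'| ≤ δt)
    (hδt₁ : δt ≤ τ₀) (hδt₂ : 3 / (Real.pi * r ^ 4) * Real.sqrt (2 * K) * δt ≤ η / 8) :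
    {z | ∃ s ∈ Icc 0 t, ∃ x : T3, ρ s x + η < mollDensity r (Ψ.flow s z) x} ∩ Ψ.good ∩
        {z | (n : ℝ)⁻¹ * configEnergy z ≤ K} ⊆
      ⋃ s ∈ St, ⋃ x ∈ Sx, {z | η / 4 < |empiricalDensityField (Ψ.flow s z) (fun y => cone r y x) -
        ∫ y, cone r y x * ρ s y|} := by
  rintro z ⟨⟨⟨s, hs, x, hx⟩, hg⟩, hKz⟩
  have hKz' : (n : ℝ)⁻¹ * configEnergy z ≤ K := hKz
  obtain ⟨sk, hsk, hssk⟩ := hSt' s hs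
  obtain ⟨xl, hxl, hxxl⟩ := hSx x
  simp only [Set.mem_iUnion, Set.mem_setOf_eq, exists_prop]
  refine ⟨sk, hsk, xl, hxl, ?_⟩
  have hc : 0 ≤ 3 / (Real.pi * r ^ 4) := by positivity
  have h1 : |mollDensity r (Ψ.flow sk z) x - mollDensity r (Ψ.flow s z) x| ≤ η / 8 := by
    refine (hclock z hg s sk x).trans ?_
    have hsqrt : Real.sqrt (2 * ((n : ℝ)⁻¹ * configEnergy z)) ≤ Real.sqrt (2 * K) :=
      Real.sqrt_le_sqrt (by linarith)
    have habs : |sk - s| ≤ δt := by rw [abs_sub_comm]; exact hssk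
    calc 3 / (Real.pi * r ^ 4) * Real.sqrt (2 * ((n : ℝ)⁻¹ * configEnergy z)) * |sk - s|
        ≤ 3 / (Real.pi * r ^ 4) * Real.sqrt (2 * K) * δt :=
          mul_le_mul (mul_le_mul_of_nonneg_left hsqrt hc) habs (abs_nonneg _)
            (mul_nonneg hc (Real.sqrt_nonneg _))
      _ ≤ η / 8 := hδt₂
  have h2 : |mollDensity r (Ψ.flow sk z) x - mollDensity r (Ψ.flow sk z) xl| ≤ η / 8 := by
    refine (hlip _ x xl).trans ?_
    calc 3 / (Real.pi * r ^ 4) * Torus.euclidDist x xl ≤ 3 / (Real.pi * r ^ 4) * δx :=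
          mul_le_mul_of_nonneg_left hxxl hc
      _ ≤ η / 8 := hδx₂
  have h3 : |ρ s x - ρ sk xl| ≤ η / 4 :=
    hmod2 s hs sk (hSt sk hsk) (hssk.trans hδt₁) x xl (hxxl.trans hδx₁)
  have h4 : ∫ y, cone r y xl * ρ sk y ≤ ρ sk xl + η / 4 := hmod1 sk (hSt sk hsk) xl
  have hed : empiricalDensityField (Ψ.flow sk z) (fun y => cone r y xl) = mollDensity r (Ψ.flow sk z) xl := rfl
  rw [hed]
  rw [abs_le] at h1 h2 h3
  refine lt_of_lt_of_le ?_ (le_abs_self _)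
  linarith [h1.1, h1.2, h2.1, h2.2, h3.1, h3.2]

/-! ## §4 The bad set is null (skeleton §2, copied) -/

theorem localGibbsLaw_compl_good (σ : ℝ) (a₀ θ₀ : T3 → ℝ) (u₀ : T3 → V3) (N : ℕ)
    (Ψ : HardSphereFlow (Torus.geometry (Fin 3)) (hsDiameter σ N) (N + 1)) :
    localGibbsLaw σ a₀ u₀ θ₀ N Ψ Ψ.goodᶜ = 0 := by
  have hL : localGibbsLaw σ a₀ u₀ θ₀ N Ψ =
      (liouville (Torus.geometry (Fin 3)) (N + 1) (hsDiameter σ N)).withDensity fun z => ENNReal.ofReal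
        (canonicalDensity (Torus.geometry (Fin 3)) (hsDiameter σ N) (N + 1) (localGibbsProfile a₀ u₀ θ₀) z) := rfl
  rw [hL]
  exact withDensity_absolutelyContinuous _ _ Ψ.measure_compl_good

/-! ## §5 STUB E — the assembly (new) -/

/-- The cone kernel is continuous in the particle slot (the test function of the grid LLN events). -/
theorem continuous_cone_left (r : ℝ) (x : T3) : Continuous fun y : T3 => cone r y x := by
  unfold cone
  simp only [Torus.euclidDist_eq]
  refine continuous_const.mul ((continuous_const.sub ?_).max continuous_const)
  exact (Torus.continuous_norm_reprSym.comp (continuous_id.sub continuous_const)).div_const r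

/-- **STUB E — `stub_gridUpgrade`, verbatim signature.** -/
theorem stub_gridUpgrade {σ : ℝ} (a₀ θ₀ : T3 → ℝ) (u₀ : T3 → V3) (Φ : Flows σ) (ρ : ℝ → T3 → ℝ)
    {t : ℝ} (ht : 0 ≤ t)
    (hdisp : ∀ N : ℕ, ∀ z ∈ (Φ N).good, ∀ s s' : ℝ,
      ((N + 1 : ℕ) : ℝ)⁻¹ * ∑ i, Torus.euclidDist (((Φ N).flow s' z i).1) (((Φ N).flow s z i).1) ≤
        Real.sqrt (2 * (((N + 1 : ℕ) : ℝ)⁻¹ * configEnergy z)) * |s' - s|)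
    {K : ℝ}
    (hK : Tendsto (fun N => localGibbsLaw σ a₀ u₀ θ₀ N (Φ N)
      {z | K < ((N + 1 : ℕ) : ℝ)⁻¹ * configEnergy z}) atTop (𝓝 0))
    (hmod : ∀ η : ℝ, 0 < η → ∃ r₀ : ℝ, 0 < r₀ ∧ r₀ ≤ 1 / 2 ∧
      (∀ r : ℝ, 0 < r → r < r₀ → ∀ s ∈ Icc 0 t, ∀ x : T3, ∫ y, cone r y x * ρ s y ≤ ρ s x + η) ∧
      ∃ τ₀ : ℝ, 0 < τ₀ ∧ ∀ s ∈ Icc 0 t, ∀ s' ∈ Icc 0 t, |s - s'| ≤ τ₀ →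
        ∀ x x' : T3, Torus.euclidDist x x' ≤ r₀ → |ρ s x - ρ s' x'| ≤ η)
    (hlln : ∀ s ∈ Icc 0 t, ∀ χ : T3 → ℝ, Continuous χ → ∀ δ : ℝ, 0 < δ →
      Tendsto (fun N => localGibbsLaw σ a₀ u₀ θ₀ N (Φ N)
        {z | δ < |empiricalDensityField ((Φ N).flow s z) χ - ∫ x, χ x * ρ s x|}) atTop (𝓝 0)) :
    CapLimit σ a₀ u₀ θ₀ Φ ρ t := by
  intro η δ hη hδ
  obtain ⟨r₀, hr₀, -, hmod1, τ₀, hτ₀, hmod2⟩ := hmod (η / 4) (by positivity)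
  refine ⟨r₀, hr₀, fun r hr hrr₀ => ?_⟩
  -- the Lipschitz constant of the kernel and the two meshes
  set L : ℝ := 3 / (Real.pi * r ^ 4) with hL
  have hLpos : 0 < L := by positivity
  set δx : ℝ := min r₀ (η / 8 / L) with hδx
  have hδxpos : 0 < δx := lt_min hr₀ (by positivity)
  set δt : ℝ := min τ₀ (η / 8 / (L * (Real.sqrt (2 * K) + 1))) with hδt
  have hsq1 : 0 < Real.sqrt (2 * K) + 1 := by positivity
  have hδtpos : 0 < δt := lt_min hτ₀ (by positivity)
  obtain ⟨Sx, hSx⟩ := exists_euclidDist_net hδxpos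
  obtain ⟨St, hSt, hSt'⟩ := exists_time_net ht hδtpos
  have hδx₁ : δx ≤ r₀ := min_le_left _ _
  have hδx₂ : L * δx ≤ η / 8 := by
    calc L * δx ≤ L * (η / 8 / L) := mul_le_mul_of_nonneg_left (min_le_right _ _) hLpos.le
      _ = η / 8 := by field_simp
  have hδt₁ : δt ≤ τ₀ := min_le_left _ _
  have hδt₂ : L * Real.sqrt (2 * K) * δt ≤ η / 8 := by
    calc L * Real.sqrt (2 * K) * δt ≤ L * (Real.sqrt (2 * K) + 1) * δt := by
          gcongr
          linarith
      _ ≤ L * (Real.sqrt (2 * K) + 1) * (η / 8 / (L * (Real.sqrt (2 * K) + 1))) :=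
          mul_le_mul_of_nonneg_left (min_le_right _ _) (by positivity)
      _ = η / 8 := by field_simp
  -- notation for the laws and the grid events
  set P : (N : ℕ) → Measure (Config (N + 1) (Fin 3) T3) := fun N => localGibbsLaw σ a₀ u₀ θ₀ N (Φ N) with hP
  set G : (N : ℕ) → ℝ → T3 → Set (Config (N + 1) (Fin 3) T3) := fun N s x =>
    {z | η / 4 < |empiricalDensityField ((Φ N).flow s z) (fun y => cone r y x) - ∫ y, cone r y x * ρ s y|}
    with hG
  -- the sure inclusion at every N (STUB D fed with the clock from `hdisp`)
  have hincl : ∀ N : ℕ, capEvent Φ N ρ t η r ⊆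
      ((Φ N).goodᶜ ∪ {z | K < ((N + 1 : ℕ) : ℝ)⁻¹ * configEnergy z}) ∪ ⋃ s ∈ St, ⋃ x ∈ Sx, G N s x := by
    intro N z hz
    by_cases hg : z ∈ (Φ N).good
    · by_cases hKz : ((N + 1 : ℕ) : ℝ)⁻¹ * configEnergy z ≤ K
      · right
        have hclock : ∀ z ∈ (Φ N).good, ∀ (s s' : ℝ) (x₀ : T3),
            |mollDensity r ((Φ N).flow s' z) x₀ - mollDensity r ((Φ N).flow s z) x₀| ≤
              3 / (Real.pi * r ^ 4) * Real.sqrt (2 * (((N + 1 : ℕ) : ℝ)⁻¹ * configEnergy z)) * |s' - s| := by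
          intro z hz s s' x₀
          rw [mul_assoc]
          exact clock_of_meanDisplacement hr _ _ x₀ (hdisp N z hz s s')
        exact stub_capEventSubset (Φ N) ρ hr hclock (mollDensity_lipschitz_centre hr) (hmod1 r hr hrr₀) hmod2
          Sx hSx hδx₁ hδx₂ St hSt hSt' hδt₁ hδt₂ ⟨⟨hz, hg⟩, hKz⟩
      · exact Or.inl (Or.inr (not_le.1 hKz))
    · exact Or.inl (Or.inl hg)
  -- union bound on the outer measure
  have hbound : ∀ N : ℕ, P N (capEvent Φ N ρ t η r) ≤
      P N {z | K < ((N + 1 : ℕ) : ℝ)⁻¹ * configEnergy z} + ∑ s ∈ St, ∑ x ∈ Sx, P N (G N s x) := by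
    intro N
    calc P N (capEvent Φ N ρ t η r)
        ≤ P N (((Φ N).goodᶜ ∪ {z | K < ((N + 1 : ℕ) : ℝ)⁻¹ * configEnergy z}) ∪ ⋃ s ∈ St, ⋃ x ∈ Sx, G N s x) :=
          measure_mono (hincl N)
      _ ≤ P N ((Φ N).goodᶜ ∪ {z | K < ((N + 1 : ℕ) : ℝ)⁻¹ * configEnergy z}) +
            P N (⋃ s ∈ St, ⋃ x ∈ Sx, G N s x) := measure_union_le _ _
      _ ≤ (P N (Φ N).goodᶜ + P N {z | K < ((N + 1 : ℕ) : ℝ)⁻¹ * configEnergy z}) +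
            ∑ s ∈ St, P N (⋃ x ∈ Sx, G N s x) :=
          add_le_add (measure_union_le _ _) (measure_biUnion_finset_le St _)
      _ ≤ (0 + P N {z | K < ((N + 1 : ℕ) : ℝ)⁻¹ * configEnergy z}) + ∑ s ∈ St, ∑ x ∈ Sx, P N (G N s x) := by
          gcongr with s _
          · exact le_of_eq (localGibbsLaw_compl_good σ a₀ θ₀ u₀ N (Φ N))
          · exact measure_biUnion_finset_le Sx _
      _ = _ := by rw [zero_add]
  -- every term tends to zero
  have hGlim : ∀ s ∈ St, ∀ x ∈ Sx, Tendsto (fun N => P N (G N s x)) atTop (𝓝 0) := by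
    intro s hs x _
    exact hlln s (hSt s hs) (fun y => cone r y x) (continuous_cone_left r x) (η / 4) (by positivity)
  have hsum : Tendsto (fun N => ∑ s ∈ St, ∑ x ∈ Sx, P N (G N s x)) atTop (𝓝 0) := by
    have h := tendsto_finsetSum St fun s hs => tendsto_finsetSum Sx fun x hx => hGlim s hs x hx
    simpa using h
  have htot : Tendsto (fun N => P N {z | K < ((N + 1 : ℕ) : ℝ)⁻¹ * configEnergy z} +
      ∑ s ∈ St, ∑ x ∈ Sx, P N (G N s x)) atTop (𝓝 0) := by
    simpa using hK.add hsum
  -- `Tendsto ⇒ ∃ N₀`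
  have hδ' : (0 : ℝ≥0∞) < ENNReal.ofReal δ := ENNReal.ofReal_pos.2 hδ
  obtain ⟨N₀, hN₀⟩ := eventually_atTop.1 (htot.eventually (Iio_mem_nhds hδ'))
  refine ⟨N₀, fun N hN => ?_⟩
  exact ((hbound N).trans (le_of_lt (hN₀ N hN)))

end DrefuteG2.StubE

end
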